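import Summits.ValiantsHypothesis.ValiantsHypothesis.Theorems.BarrierLeverPartitionMinorsHitByVPHiddenStatesBallCutCertKitFast

/-!
# Route BarrierLever — item `PartitionMinorsHitByVP` (stmt-ValiantsHypothesis-19717), line `hidden-states`:
# ★★ THE CORES OF THE t = 4 CHART OF THE THIRD SHELL (support 12, part 2) — 20 totally unbalanced 3-swap classes served for every `h` (support 12: classes 22–41 of 61)

Helper file (`--supports stmt-ValiantsHypothesis-19717`, `--computational`; cell valiant-natproofs, 𝒟-side door (c), registered line
`Cruxes/PartitionMinorsHitByVP/Lines/hidden_states.lean` v10; prover seat val-np-p6 gen 22; planner SUCCESSOR MANDATE STATUS l.1830 (P2)).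
Closes NO item.  WHAT IS CHECKED: the CORES (classes without a g20 path certificate) of the chart of ALL totally unbalanced 3-swap families at `t = 4` up to
isomorphism (val-np-p6 g22 kit j333365: 607 994 classes, supports 6 … 27, 607 565 path-certified, 429 CORES of supports 6 … 15;
HOME/val-np-p6/g22/kit/cores_t4.txt, j333365.chart4-t4.stdout.log), restricted to the blocks
named in the title; each class is six naturals (binary codes of `A_0, A_1, A_2, C_0, C_1, C_2`) inside ONE string literal per block
(`level4Data_n_i`), one `native_decide` per block runs `certCheckList3N` (`…BallCutCertKitFast`: shape check + fast canonical table at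
`stdTable s n` mod 65521 + packed LU + val-np-p4 g30's verified checkers), and `exists_table_of_mem_parseClassesN` serves every coded class
for every `h` (`level4_served_n_i`).  HONEST LABEL: computational lane (`Lean.ofReduceBool`); «`S₃` at `t = 4` for every `h`» needs all
supports (same recipe: HOME/val-np-p6/g22/kit/gen_level_str.py) and the CLASSIFICATION as a Lean theorem; 19717 stays OPEN; nothing on
crux 14610 or VP ≠ VNP.
-/

set_option linter.dupNamespace false

namespace Summit.ValiantsHypothesis.ValiantsHypothesis.Theorems.BarrierLever.HiddenStates

open Finset

namespace BallCut

open SymbJoin MoorePeel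

/-- The t = 4 chart, support 12, classes 22–41 (of 61), coded: six naturals per class. -/
def level4Data_12_21 : String := "
3840 2584 166 3296 1476 805  3840 3096 166 3296 724 565  3840 1672 86 2288 2276 1557  3840 1800 1793 2288 2246 2102  3840 3592 165 2288 1222 566  3840 3592 150 2288 1252 597  3840 3592 204 2288 1414 837  3840 3592 396 2288 1222 781  3840 240 30 3776 3488 865
3840 240 1046 3776 2472 865  3840 2224 650 3776 1324 361  3840 2224 178 3776 1324 793  3840 2224 178 3776 1324 849  3840 720 15 3296 2480 1392  3840 720 46 3296 2480 1361  3840 720 526 3296 2480 1361  3840 720 3082 3296 412 345  3840 2704 1162 3296 348 313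
3840 2704 338 3296 796 1249  3840 2704 338 3296 1228 793
"

/-- **CERTIFICATE CHECK** for `level4Data_12_21` (20 classes, `794 × 794` matrices, seed 7; computational, `Lean.ofReduceBool`). -/
theorem level4Data_12_21_check : certCheckList3N 12 4 7 65521 (parseClasses level4Data_12_21) = true := by
  native_decide

/-- ★ Every class coded in `level4Data_12_21` is served, for every `h`. -/
theorem level4_served_12_21 (e : ℕ × ℕ × ℕ × ℕ × ℕ × ℕ) (he : e ∈ parseClasses level4Data_12_21) {h : ℕ} (σ : Fin 12 ↪ Fin h)
    {r : ℕ} (u cols : Fin r → Finset (Fin h)) (hu : Function.Injective u)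
    (hU : ∀ i, ((u i).card ≤ 4 ∧ ∀ j, u i ≠ (codedA 12 e j).map σ) ∨ ∃ j, u i = (codedC 12 e j).map σ)
    (hcols : ∀ J : Finset (Fin h), J.card ≤ 4 → ∃ k, cols k = J) :
    ∃ tx : Option (Fin h) → Fin h → ℂ,
      (Matrix.of fun i k : Fin r => ∏ a ∈ u i, (tx none a + ∑ q ∈ cols k, tx (some q) a)).det ≠ 0 :=
  exists_table_of_mem_parseClassesN 12 4 7 prime_65521 (by norm_num [packBase]) _ level4Data_12_21_check e he σ
    u cols hu hU hcols

end BallCut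

end Summit.ValiantsHypothesis.ValiantsHypothesis.Theorems.BarrierLever.HiddenStates
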